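import Literature.Computability.Complexity.BitLayout
import HarnessLib

/-!
# Bit layouts: reading a laid-out datum at an offset of a bit string

Trunk T-CPLX-CORE, generic; companion of `BitLayout.lean`. `L.readAt r off` decodes the datum of
layout `L : BitLayout α N` from the bits `off … off + N - 1` of the list `r` (missing bits read
`false`), and the combinators decode componentwise at the expected offsets: `readAt_prod_fst/snd`
(second component at `off + N₁`), `readAt_pi` (block `i` at `off + i N`), `readAt_sigmaPi`
(block `i` at `off + Σ_{l<i} N_l`), `readAt_ofEquiv`, and the base cases `readAt_vector_get`,
`readAt_zvec`, `readAt_finPow_val` (the binary value), `toList_readAt_vector` (a slice of the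
string). This is the dictionary between a machine slicing its coin string and the abstract coins
of the App. D campaign (`Literature.Barriers.PneNP.AkaviaEtAl2006_complMemAM`). All proved, [folklore].

## References

* [AroraBarakCC2009] S. Arora, B. Barak, *Computational Complexity: A Modern Approach*, CUP 2009,
  §1.2 (representing objects as strings).
-/

namespace Literature.Computability.Complexity

open Finset

namespace BitLayout

variable {α β : Type*} {N N₁ N₂ : ℕ}

/-- **Decoding at an offset** of a bit string (missing bits read `false`). [folklore] -/
def readAt (L : BitLayout α N) (r : List Bool) (off : ℕ) : α := L.equiv.symm fun j => r.getD (off + j) false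

/-- Reading at offset `0` is decoding the prefix. [folklore] -/
theorem readAt_zero (L : BitLayout α N) (r : List Bool) : L.readAt r 0 = L.equiv.symm fun j => r.getD j false := by
  simp [readAt]

/-- Transported layouts read through the bijection. [folklore] -/
@[simp] theorem readAt_ofEquiv (e : β ≃ α) (L : BitLayout α N) (r : List Bool) (off : ℕ) :
    (ofEquiv e L).readAt r off = e.symm (L.readAt r off) := rfl

/-- The first component of a pair is read at the same offset. [folklore] -/
@[simp] theorem readAt_prod_fst (L₁ : BitLayout α N₁) (L₂ : BitLayout β N₂) (r : List Bool) (off : ℕ) :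
    ((prod L₁ L₂).readAt r off).1 = L₁.readAt r off := by
  simp [readAt]

/-- The second component of a pair is read `N₁` bits later. [folklore] -/
@[simp] theorem readAt_prod_snd (L₁ : BitLayout α N₁) (L₂ : BitLayout β N₂) (r : List Bool) (off : ℕ) :
    ((prod L₁ L₂).readAt r off).2 = L₂.readAt r (off + N₁) := by
  simp [readAt, Nat.add_assoc]

/-- Block `i` is read `i N` bits later. [folklore] -/
@[simp] theorem readAt_pi (L : BitLayout α N) (k : ℕ) (r : List Bool) (off : ℕ) (i : Fin k) :
    (pi L k).readAt r off i = L.readAt r (off + i * N) := by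
  simp only [readAt, pi_symm_apply]
  congr 1; funext j
  rw [pi_pos]; ac_rfl

/-- Block `i` of a dependent tuple is read `Σ_{l<i} N_l` bits later. [folklore] -/
@[simp] theorem readAt_sigmaPi {k : ℕ} {βf : Fin k → Type*} {Nf : Fin k → ℕ} (L : ∀ i, BitLayout (βf i) (Nf i))
    (r : List Bool) (off : ℕ) (i : Fin k) :
    (sigmaPi L).readAt r off i = (L i).readAt r (off + ∑ l : Fin i, Nf (Fin.castLE i.2.le l)) := by
  simp [readAt, Nat.add_assoc]

/-- A bit vector read at an offset: bit `i` is bit `off + i`. [folklore] -/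
@[simp] theorem readAt_vector_get (k : ℕ) (r : List Bool) (off : ℕ) (i : Fin k) :
    ((vector k).readAt r off).get i = r.getD (off + i) false := by
  simp [readAt]

/-- **A bit vector read at an offset is a slice of the string** (when the string is long enough). [folklore] -/
theorem toList_readAt_vector (k : ℕ) (r : List Bool) (off : ℕ) (h : off + k ≤ r.length) :
    ((vector k).readAt r off).toList = (r.drop off).take k := by
  apply List.ext_getElem
  · simp; omega
  · intro i h1 h2
    have hi : i < k := by simpa using h1
    have e1 : ((vector k).readAt r off).toList[i] = ((vector k).readAt r off).get ⟨i, hi⟩ := by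
      simp [List.Vector.get_eq_get_toList]
    rw [e1, readAt_vector_get]
    simp only [List.getElem_take, List.getElem_drop]
    rw [List.getD_eq_getElem?_getD, List.getElem?_eq_getElem (by omega)]
    rfl

/-- A vector over `𝔽₂` read at an offset. [folklore] -/
@[simp] theorem readAt_zvec (k : ℕ) (r : List Bool) (off : ℕ) (i : Fin k) :
    (zvec k).readAt r off i = zmod2Equiv.symm (r.getD (off + i) false) := rfl

/-- **A binary number read at an offset: its value.** [folklore] -/
theorem readAt_finPow_val (k : ℕ) (r : List Bool) (off : ℕ) :
    ((finPow k).readAt r off : ℕ) = ∑ i : Fin k, (r.getD (off + i) false).toNat * 2 ^ (i : ℕ) := by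
  simp [readAt, finPow_symm_val]

/-- A matrix over `𝔽₂` read at an offset, row-major. [folklore] -/
@[simp] theorem readAt_matrix (k m : ℕ) (r : List Bool) (off : ℕ) (i : Fin k) (j : Fin m) :
    (matrix k m).readAt r off i j = zmod2Equiv.symm (r.getD (off + (i * m + j)) false) := by
  have h := readAt_pi (zvec m) k r off i
  have h' : (matrix k m).readAt r off i = (zvec m).readAt r (off + i * m) := h
  rw [h', readAt_zvec, Nat.add_assoc]

/-- An affine hash function read at an offset: the matrix, then the offset vector. [folklore] -/
theorem readAt_hash (m k : ℕ) (r : List Bool) (off : ℕ) :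
    (hash m k).readAt r off = ((matrix k m).readAt r off, (zvec k).readAt r (off + k * m)) := by
  unfold hash; exact Prod.ext (readAt_prod_fst _ _ _ _) (readAt_prod_snd _ _ _ _)

end BitLayout

end Literature.Computability.Complexity
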